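import Literature.AnabelianGeometry.EtaleTheta.LogDivisorModelTateTowerKummerRootLaw
import Literature.AnabelianGeometry.EtaleTheta.Discharge.Sec4CondDAtTowerDatum
import Literature.AnabelianGeometry.EtaleTheta.Discharge.Sec3Prop34iPhiZero

/-!
# [EtTh] ERRATUM E2 / Def. 4.1 (ii) A10 / Prop. 4.2 (iii) at the Kummer–Tate tower: the C-R34 (3) chain instantiated
# with its E2 (a) input DISCHARGED (a model where `RootLaw (ofTower T)` holds non-degenerately)

S. Mochizuki, *The étale theta function …*, Publ. RIMS **45** (2009) [MochizukiEtTh2009], §3 Def. 3.3 (iii) p.73, §4 Def. 4.1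
(i)–(ii) p.86, Prop. 4.2 (iii) p.89; ERRATUM E2 = [IUTchI] Rmk. 3.2.4 (i)(a)/(iv) [cite: MochizukiEtTh2009, Prop 4.2 (iii) p.89].

PROOF-ONLY (abc-iut cell, W6 seat d058 lineage, gen 3; 0 defs; L2-lead R520 «natural sequel»).  abc-iut-L2-t3's chain of
record (`Sec4GaloisLiftOfFullEssSurj` p456136, `Sec4CondDAtTowerDatum` p456421): `(DivisorMonoids.ofTower T).RootLaw` ⟹
A10 `BaseRootLaw` ⟹ hR ⟹ condition (d) of the canonical §4 model, for every tempered Frobenioid over the type-`ℤ` weak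
realified data of `ofTower T` with full, essentially surjective base.  Its E2 (a) input was, so far, a HYPOTHESIS with no
non-degenerate instance (one-level towers force `B₀ = 1`).  At the Kummer–Tate tower (`TateTowerKummer.tower`, p457919;
`TateTowerKummer.rootLaw`, `LogDivisorModelTateTowerKummerRootLaw.lean`) that input is a THEOREM, with `B₀ ≠ F₀`:
* `TateTowerKummer.hpf` — the perf-factorial slot of `ofTower tower` (abc-iut-w6-d057's `isPerfFactorialCof_phiZero` at
  the level of each covering);
* **`TateTowerKummer.baseRootLaw_top_of_full_essSurj`** — A10 `BaseRootLaw ⊤` for EVERY tempered Frobenioid over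
  `ofRlfZWeak (ofTower tower) hpf` with full, essentially surjective base — NO `RootLaw` hypothesis left;
* **`TateTowerKummer.condD_mkOfModelCanonical_of_full_essSurj`** — condition (d) at every object of the canonical §4
  model (`IG := ⊤`) over such a tempered Frobenioid — the standing §4-model binders (`hP`, `hΦd`, `hTF`, Galois data,
  `NH`, the Frobenius-trivial anchor) remain, `hR` is GONE.
(The `IG := «Galois»` variants need `IsTempered Grp`, not proved here.)  HONEST FRAMING: instantiation at a combinatorial
consistency witness; whether a tempered Frobenioid with full essentially surjective base EXISTS over this tower is not
claimed; nothing here bears on [IUTchIII] Cor. 3.12; no side taken; typed ≠ proved.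
-/

noncomputable section

namespace Literature.AnabelianGeometry.EtaleTheta

open CategoryTheory Opposite Function Literature.AlgebraicGeometry.Frobenioids
  Literature.AlgebraicGeometry.Frobenioids.QuasiTemperoid Literature.AnabelianGeometry.SemiGraphs LogDivisorTower

namespace TateTowerKummer

universe u₀ v₀

/-- **Prop. 3.4 (i) (weak-cof) slot for `ofTower tower`**: `Φ₀(Y) = Hom_Γ(Y, Div⁺(Z_∞^{(lvl Y)}))` is perf-factorial (weak-cof)
for every connected tempered covering `Y` (abc-iut-w6-d057's `isPerfFactorialCof_phiZero` at the action `act`).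
[cite: MochizukiEtTh2009, Prop 3.4 p.74] -/
theorem hpf (Y : (ConnectedPart (BTemp Grp))ᵒᵖ) : IsPerfFactorialCof ((DivisorMonoids.ofTower tower).Φ₀.obj Y) :=
  LogDivisorModel.GaloisAction.isPerfFactorialCof_phiZero act Y.unop.obj.obj

variable {D : Type u₀} [Category.{v₀} D] {VD : FrdICatStub.{u₀, v₀, 0} D}
  (tf : TemperedFrobenioid (RealifiedDivisorMonoids.ofRlfZWeak (DivisorMonoids.ofTower tower) hpf) D VD)
  [tf.base.Full] [tf.base.EssSurj]

/-- **A10 `BaseRootLaw ⊤` at the Kummer–Tate tower, NO E2 hypothesis**: for every tempered Frobenioid over the type-`ℤ`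
weak realified data of `ofTower tower` whose base functor is full and essentially surjective, every object's base admits
the root-lift property of Def. 4.1 (ii) (abc-iut-L2-t3's `baseRootLaw_top_of_rootLaw_of_full_essSurj` fed with
`TateTowerKummer.rootLaw`). [cite: MochizukiEtTh2009, Prop 4.2 (iii) p.89] -/
theorem baseRootLaw_top_of_full_essSurj : tf.BaseRootLaw fun _ => True :=
  tf.baseRootLaw_top_of_rootLaw_of_full_essSurj rootLaw

variable {K : Type 1} [Field K] (X : SemiGraphs.TemperedArithmeticGroup.{1} K)
  (hP : ∀ A : Dᵒᵖ, IsPerfect (tf.Φ.carrier A))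

/-- **Condition (d) of the canonical §4 model (`IG := ⊤`) at the Kummer–Tate tower, NO E2 hypothesis** — abc-iut-L2-t3's
`condD_mkOfModelCanonical_of_rootLaw_of_full_essSurj` with `hR := TateTowerKummer.rootLaw`; the remaining binders are the
standing §4-model binders of p450859. [cite: MochizukiEtTh2009, Def 4.1 (i) p.86] -/
theorem condD_mkOfModelCanonical_of_full_essSurj
    (gS : ∀ A : D, True → (X.Pi →* Aut A)) (gSs : ∀ (A : D) (h : True), Function.Surjective (gS A h))
    (NH : Subgroup (Field.absoluteGaloisGroup K) → tf.category → ℕ+ → Prop) (A₀ : tf.category)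
    (hA₀ : PreFrobenioid.IsFrobeniusTrivial tf.toElem A₀)
    (hΦd : Objectwise (fun M _ => IsDivisorial M) tf.divisorMonoid)
    (hTF : ∀ (A : D) (N : ℕ), 0 < N →
      Function.Injective fun x : Algebra.GrothendieckGroup
        ((RealifiedDivisorMonoids.ofRlfZWeak (DivisorMonoids.ofTower tower) hpf).ΦR.obj (op (tf.base.obj A))) => x ^ N)
    (A : (BiKummerSetting.mkOfModelCanonical X tf rfl hP (fun _ => True) gS gSs NH A₀ hA₀ trivial).C)
    (f : (BiKummerSetting.mkOfModelCanonical X tf rfl hP (fun _ => True) gS gSs NH A₀ hA₀ trivial).biratUnits A) :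
    BiKummerSetting.FractionPair.CondD (f := f) (fun {_} φ x => tf.pullFracModel φ x) :=
  BiKummerSetting.Prop42Sub.condD_mkOfModelCanonical_of_rootLaw_of_full_essSurj X tf hP gS gSs NH A₀ hA₀ hΦd hTF
    rootLaw A f

end TateTowerKummer

end Literature.AnabelianGeometry.EtaleTheta

end
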